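import Literature.MathematicalPhysics.QuantumFieldTheory.Balaban1983to89.B1Ineq225ZeroFieldTorusLevels
import Literature.MathematicalPhysics.QuantumFieldTheory.Balaban1983to89.B1Ineq233LowerZeroFieldTorus

/-!
# `Balaban1983to89.B1Cor23ZeroFieldTorus` — T. Bałaban, *(Higgs)₂,₃ quantum fields in a finite volume. I. A lower bound*, Commun. Math.
# Phys. **85** (1982) 603–626 [Balaban1982Higgs1] with *Regularity and decay of lattice Green's functions*, Commun. Math. Phys. **89** (1983)
# 571–597 [Balaban1983RegularityDecay]: the `L²` pairing form of [B4] Corollary 2.3 (2.30) — `|⟨g, G^ε_k(T_ε,0)g′⟩| ≦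
# c₀(L^kε)²e^{−δ₀dist(supp g, supp g′)/L^k}‖g‖₂‖g′‖₂` — PROVED FOR THE (Higgs)₂,₃ MODEL AT ZERO FIELD on the torus sub-family `M·L′_μ = L^m`,
# every level `1 ≦ k ≦ K`, every coupling, every `N`; hence Prop. 2.3 (2.34)/(2.36) AT ZERO FIELD ON THE WHOLE TORUS hold there with NO
# displayed input (r14's `B1Ineq233LowerZeroFieldTorus.ineq234_zeroField_of_sep` / `ineq236_zeroField_of_sep`, input `hSep` DISCHARGED)

statement-level skeleton of published theorems with citation tags; proofs where landed; nothing here is a claim about the Yang–Mills mass gap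

PDF held: `paper:balaban1982-cmp85-higgs23-i` (journal page = PDF page + 602); p. 604 [PDF 2] ((1.3), (1.5)), p. 610 [PDF 8] ((2.20), (2.25)),
p. 611–612 [PDF 9–10] (Prop. 2.3 (2.33)–(2.36)); ×2 renders `…/1982-cmp85-higgs23-I/1982-cmp85-higgs23-I-p002|p008|p009|p010-x2.png`; B4 p. 580
[PDF 10] (Remark, Corollary 2.3 (2.30)), p. 594 [PDF 24] (Sect. 5), held `paper:balaban1983-cmp89-regularity-decay`.

CITATION HEADER (lean-in-tree rule).  Cell `lit-balaban` (HOME `run/shared/lean/pub/lit-balaban/`), Phase-2 proof seat **p14** gen 9 (unit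
`lit-balaban-p14`), file 4 of four; SKELETON rows **B4.Cor2.3** ((2.30), first pairing, at `A = 0` on the torus: MODEL INSTANCE on the
(Higgs)₂,₃ carrier, owner r01) and **B1.Prop2.3** ((2.34)/(2.36) at `A = 0`, `Ω = T_ε`, unconditional on the sub-family; owner r14).  USED BY NAME,
never restated:
this seat's files 1–3 (`setupAt`, `eSiteAt`, `cmpAt`, `cmpAt_propagatorK`, `T_eq_tdist_symm`, `torus_decay_bound`, `eps_setupAt_mul`,
`rowSum_abs_le`, `abs_dot_mulVec_le`), `B5Display136Torus.G_eq_smul_Grs`, `B4Ineq115Torus.Grs_isSymm`, `B5Ineq137Torus.{T, T_symm}`, the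
typer's `HiggsLattice.{siteInner, Site.tdist}`, `HiggsCovariance.propagatorK`, r14's `B1Ineq233LowerZeroFieldTorus.{ineq234_zeroField_of_sep,
ineq236_zeroField_of_sep}` with all the vocabulary of their statements (`B1Eq230FluctCov.mat/Ix`, `HiggsCondCov232.condCov232/deltaCov235`,
`B4Sect5Torus.cSt/dSt`, `B1Ineq234Concrete.profile/distC`, `B2Prop31ZeroFieldConcrete.gamma0`, `HiggsFluctMeasure.coeff221`).

WHAT IS PRINTED (verbatim).  B4 p. 580 [PDF 10]: *"Remark. Let us notice that this lemma alone implies a weaker version of Proposition I.2.1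
with L²-norms. More exactly we have Corollary 2.3. If Ω and A are as in Proposition I.2.1, then there exist positive constants c₀, δ₀ such
that for arbitrary scalar field configurations f, f′ defined on Ω, we have |⟨f, G_k(Ω,A)f′⟩|, … ≦ c₀e^{−δ₀dist(supp f, supp f′)}‖f‖₂‖f′‖₂.
(2.30)"*; p. 581: *"it is enough to prove it for f, f′ with supports in unit cubes"*; B1 p. 611 [PDF 9], Prop. 2.3: *"|C^{(k)}_Λ(Ω, A; y, y′)| ≦
c₀ exp(−δ₀|y − y′|), y, y′ ∈ Λ. (2.34)"*; p. 612: *"|δC^{(k)}_Λ(Ω, A; y, y′)| ≦ c₀ exp(−δ₀(dist(y, Λᶜ) + |y − y′| + dist(y′, Λᶜ))) (2.36)"*.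

WHAT THIS FILE PROVES (kernel-checked, zero `sorry`, theorems only; axioms standard).
* §1 `siteInner_eq_sum_dot` (`⟨g, h⟩ = ε^dΣ_i⟨cmp_i g, cmp_i h⟩_{ℓ²}`), `sum_sq_cmpAt_eq`, and **`propagatorK_pairing_bound`** — for `d ≧ 1`, odd
  `L > 1`, `a > 0`, `m² ≧ 0`, any `ε₀`, `N`: `δ₀, c₀ > 0` with `|⟨g, G^ε_k(T_ε,0)g′⟩| ≦ c₀(L^kε)²e^{−δ₀R/L^k}‖g‖₂‖g′‖₂` on every torus of the
  sub-family, every coupling, every `1 ≦ k ≦ K` with `L^kε ≦ ε₀`, whenever the supports of `g, g′` are `≧ R` apart in (1.3) (lattice units of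
  `T_ε`; `R/L^k` = distance in units of `L^kε`) — file 3's sup-norm decay turned into an `L²` bound by Schur's test (rows from
  `torus_decay_bound` on sign test functions, columns by the symmetry of `G_k`).
* §2 **PROP. 2.3 (2.34)/(2.36) AT ZERO FIELD ON THE WHOLE TORUS, UNCONDITIONAL ON THE SUB-FAMILY**: `ineq234_zeroField_torus`,
  `ineq236_zeroField_torus` — r14's `ineq234_zeroField_of_sep` / `ineq236_zeroField_of_sep` VERBATIM (their explicit `(c₁, δ₁)` through
  `cSt/dSt`) with the input `hSep` supplied by §1 at `ε₀ = 1` (`1 ≦ k < K`, `L^kε ≦ 1`, `m² > 0`, `a > 0`).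
HONEST SCOPE: `A = 0`, `Ω = T_ε`, the sub-family `M·L′_μ = L^m` with `L` odd; constants existential; the remaining three pairings of (2.30) (with
covariant derivatives) are not treated; background fields `A ≠ 0` NOT covered; the `(L^{k+1}ε)^{−2}` inside r14's `c₁` is theirs (see their HONEST
SCOPE).  Unit `lit-balaban-p14` gen 9 (literature-prover-lit-balaban-p14-g9-0).
-/

open scoped BigOperators InnerProductSpace
open Matrix

namespace Literature.MathematicalPhysics.QuantumFieldTheory.Balaban1983to89.B1Cor23ZeroFieldTorus

open Literature.MathematicalPhysics.QuantumFieldTheory.Balaban1983to89.HiggsLattice (ChargeData siteInner)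
open Literature.MathematicalPhysics.QuantumFieldTheory.Balaban1983to89.HiggsCovariance (propagatorK)
open Literature.MathematicalPhysics.QuantumFieldTheory.Balaban1983to89.B1RG242Torus (tower)
open Literature.MathematicalPhysics.QuantumFieldTheory.Balaban1983to89.B5Display136Torus (G_eq_smul_Grs)
open Literature.MathematicalPhysics.QuantumFieldTheory.Balaban1983to89.B4Ineq115Torus (Grs_isSymm)
open Literature.MathematicalPhysics.QuantumFieldTheory.Balaban1983to89.B5Ineq137Torus (T T_nonneg)
open Literature.MathematicalPhysics.QuantumFieldTheory.Balaban1983to89.B1Eq211ZeroFieldTorus (Shape)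
open Literature.MathematicalPhysics.QuantumFieldTheory.Balaban1983to89.B1Eq211ZeroFieldTorusLevels (setupAt setupAt_d setupAt_L
  eSiteAt cmpAt cmpAt_apply cmpAt_apply_eSiteAt)
open Literature.MathematicalPhysics.QuantumFieldTheory.Balaban1983to89.B1Eq220ZeroFieldTorusLevels (cmpAt_propagatorK T_eq_tdist_symm)
open Literature.MathematicalPhysics.QuantumFieldTheory.Balaban1983to89.B1Ineq225ZeroFieldTorusLevels (torus_decay_bound eps_setupAt_mul
  rowSum_abs_le abs_dot_mulVec_le)

variable {P : HiggsLattice.Params}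

/-! ## §1 The `L²` pairing form of [B4] Cor. 2.3 for `G^ε_k(T_ε, 0)` -/

section Pairing

variable (S : Shape P) {k : ℕ} (hk : k ≤ P.K) {N : ℕ}

/-- **The scalar product (1.5) through the components on the level-`k` torus**: `⟨g, h⟩ = ε^d Σ_i ⟨cmp_i g, cmp_i h⟩_{ℓ²}`.
[cite: Balaban1982Higgs1, (1.5) p.604] -/
theorem siteInner_eq_sum_dot (g h : HiggsLattice.ScalarField P 0 N) :
    siteInner g h = P.mesh 0 ^ P.d * ∑ i : Fin N, (cmpAt S hk i g ⬝ᵥ cmpAt S hk i h) := by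
  unfold HiggsLattice.siteInner
  rw [← Finset.mul_sum]
  congr 1
  have hinner : ∀ x : HiggsLattice.Site P 0, ⟪g x, h x⟫_ℝ = ∑ i, g x i * h x i := fun x => by
    rw [PiLp.inner_apply]
    refine Finset.sum_congr rfl fun i _ => ?_
    simp [mul_comm]
  simp_rw [hinner]
  rw [Finset.sum_comm]
  refine Finset.sum_congr rfl fun i _ => ?_
  simp only [dotProduct, cmpAt_apply]
  exact Fintype.sum_equiv (eSiteAt S hk (Nat.zero_le _)) _ _ (fun x => by rw [Equiv.symm_apply_apply])

/-- `‖g‖² = ε^d Σ_i Σ_z (cmp_i g)(z)²` ((1.5)), solved for the `ℓ²` mass of the components. [cite: Balaban1982Higgs1, (1.5) p.604] -/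
theorem sum_sq_cmpAt_eq (g : HiggsLattice.ScalarField P 0 N) :
    ∑ i : Fin N, ∑ z, (cmpAt S hk i g z) ^ 2 = (P.mesh 0 ^ P.d)⁻¹ * siteInner g g := by
  have hε : P.mesh 0 ^ P.d ≠ 0 := pow_ne_zero _ (P.mesh_pos 0).ne'
  rw [siteInner_eq_sum_dot S hk, ← mul_assoc, inv_mul_cancel₀ hε, one_mul]
  refine Finset.sum_congr rfl fun i _ => ?_
  simp only [dotProduct, sq]

/-- **THE `L²` PAIRING FORM OF [B4] COR. 2.3 FOR THE MODEL'S `G^ε_k(T_ε, 0)`, EVERY LEVEL — PROVED**: for `d ≧ 1`, odd `L > 1`, `a > 0`,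
`m² ≧ 0`, any `ε₀`, `N` there are `δ₀, c₀ > 0` such that on every torus of the sub-family, for every coupling, every `1 ≦ k ≦ K` with `L^kε ≦ ε₀`
and all `g, g′` whose supports are `≧ R` apart in the distance (1.3) (lattice units of `T_ε`):
`|⟨g, G^ε_k(T_ε,0)g′⟩| ≦ c₀(L^kε)²e^{−δ₀R/L^k}‖g‖₂‖g′‖₂` (scalar product and norms (1.5)) — the sup-norm decay of §1 turned into an `L²`
bound by Schur's test and the symmetry of `G_k` (B4 p. 580: *"this lemma alone implies a weaker version of Proposition I.2.1 with
L²-norms"*).  This is the input `hSep` of `B1Ineq233LowerZeroFieldTorus.ineq234_zeroField_of_sep` (with the extra `(L^kε)² ≦ 1`).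
[cite: Balaban1983RegularityDecay, Corollary 2.3 (2.30) p.580; Balaban1982Higgs1, Prop. 2.1 (2.25) p.610] -/
theorem propagatorK_pairing_bound (d L N : ℕ) (hd : 1 ≤ d) (hL : Odd L ∧ 1 < L) {a : ℝ} (ha : 0 < a) {msq : ℝ} (hmsq : 0 ≤ msq)
    (ε₀ : ℝ) :
    ∃ δ₀ c₀ : ℝ, 0 < δ₀ ∧ 0 < c₀ ∧ ∀ (P : HiggsLattice.Params) (S : Shape P), P.d = d → P.L = L →
      ∀ (C : ChargeData N) {k : ℕ}, 1 ≤ k → k ≤ P.K → P.mesh k ≤ ε₀ →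
        ∀ (R : ℝ) (g g' : HiggsLattice.ScalarField P 0 N),
          (∀ x x', g x ≠ 0 → g' x' ≠ 0 → R ≤ (HiggsLattice.Site.tdist x x' : ℝ)) →
            |siteInner g (propagatorK C Finset.univ (0 : HiggsLattice.VecField P 0) msq a k g')|
              ≤ c₀ * P.mesh k ^ 2 * Real.exp (-(δ₀ * (R / (P.L : ℝ) ^ k))) *
                  Real.sqrt (siteInner g g) * Real.sqrt (siteInner g' g') := by
  obtain ⟨δ₀, c, hδ₀, hc, hG⟩ := torus_decay_bound d L hd hL ha (show 0 ≤ msq * ε₀ ^ 2 by positivity)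
  refine ⟨δ₀, c, hδ₀, hc, ?_⟩
  intro P S hPd hPL C k hk1 hk hε R g g' hsep
  have hℓ : 0 < P.mesh k := P.mesh_pos k
  have hm'0 : 0 ≤ msq * P.mesh k ^ 2 := mul_nonneg hmsq (sq_nonneg _)
  have hcap : msq * P.mesh k ^ 2 ≤ msq * ε₀ ^ 2 := mul_le_mul_of_nonneg_left (pow_le_pow_left₀ hℓ.le hε 2) hmsq
  have hLk : 0 < (P.L : ℝ) ^ k := by
    have : (0 : ℝ) < P.L := by rw [hPL]; exact_mod_cast (show 0 < L by have := hL.2; omega)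
    exact pow_pos this k
  have hD0 : 0 ≤ max R 0 := le_max_right _ _
  have hexp : Real.exp (-(δ₀ * ((setupAt S k).eps * max R 0))) ≤ Real.exp (-(δ₀ * (R / (P.L : ℝ) ^ k))) := by
    rw [eps_setupAt_mul, Real.exp_le_exp]
    have h1 : R / (P.L : ℝ) ^ k ≤ max R 0 / (P.L : ℝ) ^ k := div_le_div_of_nonneg_right (le_max_left _ _) hLk.le
    nlinarith
  have hB0 : 0 ≤ c * Real.exp (-(δ₀ * (R / (P.L : ℝ) ^ k))) := by positivity
  -- the supports read on the level-`k` torus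
  have hsuppT : ∀ (i j : Fin N) (z z' : Site (setupAt S k) 0), cmpAt S hk i g z ≠ 0 → cmpAt S hk j g' z' ≠ 0 →
      max R 0 ≤ T (setupAt S k) 0 z z' := by
    intro i j z z' hz hz'
    refine max_le ?_ (T_nonneg _ 0 z z')
    rw [T_eq_tdist_symm S hk (Nat.zero_le _)]
    refine hsep _ _ (fun h0 => hz ?_) (fun h0 => hz' ?_)
    · rw [cmpAt_apply, h0]; rfl
    · rw [cmpAt_apply, h0]; rfl
  -- `G_k` of the level-`k` torus tower is symmetric
  have hsym : ∀ z z' : Site (setupAt S k) 0, (tower (setupAt S k) a (msq * P.mesh k ^ 2)).G k z' z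
      = (tower (setupAt S k) a (msq * P.mesh k ^ 2)).G k z z' := by
    have h : ((tower (setupAt S k) a (msq * P.mesh k ^ 2)).G k).IsSymm := by
      rw [G_eq_smul_Grs (P := setupAt S k) ha hm'0 hk1]
      exact (Grs_isSymm (P := setupAt S k) a (msq * P.mesh k ^ 2) k).smul _
    exact fun z z' => h.apply z z'
  -- rows through `supp cmp_i g`, summed over `supp cmp_j g′`
  have hrow : ∀ (i j : Fin N) (z : Site (setupAt S k) 0), cmpAt S hk i g z ≠ 0 →
      ∑ z', (if cmpAt S hk j g' z' ≠ 0 then |(tower (setupAt S k) a (msq * P.mesh k ^ 2)).G k z z'| else 0)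
        ≤ c * Real.exp (-(δ₀ * (R / (P.L : ℝ) ^ k))) := by
    intro i j z hz
    refine rowSum_abs_le _ (cmpAt S hk j g') z fun f hf1 hfw => ?_
    have h := hG (setupAt S k) hPd hPL hk1 (msq * P.mesh k ^ 2) hm'0 hcap z f 1 (max R 0) hf1 hD0
      (fun z' hz' => hsuppT i j z z' hz (hfw z' hz'))
    rw [mul_one] at h
    exact h.trans (mul_le_mul_of_nonneg_left hexp hc.le)
  -- columns through `supp cmp_j g′`, summed over `supp cmp_i g` (symmetry)
  have hcol : ∀ (i j : Fin N) (z' : Site (setupAt S k) 0), cmpAt S hk j g' z' ≠ 0 →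
      ∑ z, (if cmpAt S hk i g z ≠ 0 then |(tower (setupAt S k) a (msq * P.mesh k ^ 2)).G k z z'| else 0)
        ≤ c * Real.exp (-(δ₀ * (R / (P.L : ℝ) ^ k))) := by
    intro i j z' hz'
    have h := rowSum_abs_le ((tower (setupAt S k) a (msq * P.mesh k ^ 2)).G k) (cmpAt S hk i g) z'
      (B := c * Real.exp (-(δ₀ * (R / (P.L : ℝ) ^ k)))) fun f hf1 hfw => by
        have h := hG (setupAt S k) hPd hPL hk1 (msq * P.mesh k ^ 2) hm'0 hcap z' f 1 (max R 0) hf1 hD0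
          (fun z hz => by
            rw [B5Ineq137Torus.T_symm]
            exact hsuppT i j z z' (hfw z hz) hz')
        rw [mul_one] at h
        exact h.trans (mul_le_mul_of_nonneg_left hexp hc.le)
    refine le_of_eq_of_le (Finset.sum_congr rfl fun z _ => ?_) h
    rw [hsym z z']
  -- Schur, component by component
  have hcomp : ∀ i : Fin N,
      |cmpAt S hk i g ⬝ᵥ ((tower (setupAt S k) a (msq * P.mesh k ^ 2)).G k *ᵥ cmpAt S hk i g')|
        ≤ c * Real.exp (-(δ₀ * (R / (P.L : ℝ) ^ k))) * Real.sqrt (∑ z, cmpAt S hk i g z ^ 2)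
            * Real.sqrt (∑ z, cmpAt S hk i g' z ^ 2) :=
    fun i => abs_dot_mulVec_le _ _ _ hB0 (fun z hz => hrow i i z hz) (fun z' hz' => hcol i i z' hz')
  -- assembling: `⟨g, G g′⟩ = ε^d (L^kε)² Σ_i ⟨cmp_i g, G_k cmp_i g′⟩`
  have hε : 0 < P.mesh 0 ^ P.d := pow_pos (P.mesh_pos 0) _
  have hid : siteInner g (propagatorK C Finset.univ (0 : HiggsLattice.VecField P 0) msq a k g')
      = P.mesh 0 ^ P.d * (P.mesh k ^ 2 * ∑ i : Fin N,
          (cmpAt S hk i g ⬝ᵥ ((tower (setupAt S k) a (msq * P.mesh k ^ 2)).G k *ᵥ cmpAt S hk i g'))) := by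
    rw [siteInner_eq_sum_dot S hk]
    congr 1
    rw [Finset.mul_sum]
    refine Finset.sum_congr rfl fun i _ => ?_
    rw [cmpAt_propagatorK S hk C hk1 ha hmsq, dotProduct_smul, smul_eq_mul]
  have hsumg : Real.sqrt (∑ i : Fin N, ∑ z, cmpAt S hk i g z ^ 2)
      = Real.sqrt ((P.mesh 0 ^ P.d)⁻¹) * Real.sqrt (siteInner g g) := by
    rw [sum_sq_cmpAt_eq S hk, Real.sqrt_mul (inv_nonneg.2 hε.le)]
  have hsumg' : Real.sqrt (∑ i : Fin N, ∑ z, cmpAt S hk i g' z ^ 2)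
      = Real.sqrt ((P.mesh 0 ^ P.d)⁻¹) * Real.sqrt (siteInner g' g') := by
    rw [sum_sq_cmpAt_eq S hk, Real.sqrt_mul (inv_nonneg.2 hε.le)]
  have hCS : ∑ i : Fin N, Real.sqrt (∑ z, cmpAt S hk i g z ^ 2) * Real.sqrt (∑ z, cmpAt S hk i g' z ^ 2)
      ≤ Real.sqrt (∑ i : Fin N, ∑ z, cmpAt S hk i g z ^ 2) * Real.sqrt (∑ i : Fin N, ∑ z, cmpAt S hk i g' z ^ 2) := by
    have h := Real.sum_mul_le_sqrt_mul_sqrt Finset.univ (fun i : Fin N => Real.sqrt (∑ z, cmpAt S hk i g z ^ 2))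
      (fun i => Real.sqrt (∑ z, cmpAt S hk i g' z ^ 2))
    simp only [Real.sq_sqrt (Finset.sum_nonneg fun _ _ => sq_nonneg _)] at h
    exact h
  have hsqε : Real.sqrt ((P.mesh 0 ^ P.d)⁻¹) * Real.sqrt ((P.mesh 0 ^ P.d)⁻¹) = (P.mesh 0 ^ P.d)⁻¹ :=
    Real.mul_self_sqrt (inv_nonneg.2 hε.le)
  rw [hid, abs_mul, abs_of_pos hε, abs_mul, abs_of_pos (pow_pos hℓ 2)]
  calc P.mesh 0 ^ P.d * (P.mesh k ^ 2 *
        |∑ i : Fin N, (cmpAt S hk i g ⬝ᵥ ((tower (setupAt S k) a (msq * P.mesh k ^ 2)).G k *ᵥ cmpAt S hk i g'))|)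
      ≤ P.mesh 0 ^ P.d * (P.mesh k ^ 2 * ∑ i : Fin N,
          (c * Real.exp (-(δ₀ * (R / (P.L : ℝ) ^ k))) * Real.sqrt (∑ z, cmpAt S hk i g z ^ 2)
            * Real.sqrt (∑ z, cmpAt S hk i g' z ^ 2))) := by
        gcongr
        exact (Finset.abs_sum_le_sum_abs _ _).trans (Finset.sum_le_sum fun i _ => hcomp i)
    _ = P.mesh 0 ^ P.d * (P.mesh k ^ 2 * (c * Real.exp (-(δ₀ * (R / (P.L : ℝ) ^ k))) *
          ∑ i : Fin N, Real.sqrt (∑ z, cmpAt S hk i g z ^ 2) * Real.sqrt (∑ z, cmpAt S hk i g' z ^ 2))) := by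
        congr 2
        rw [Finset.mul_sum]
        refine Finset.sum_congr rfl fun i _ => ?_
        ring
    _ ≤ P.mesh 0 ^ P.d * (P.mesh k ^ 2 * (c * Real.exp (-(δ₀ * (R / (P.L : ℝ) ^ k))) *
          (Real.sqrt (∑ i : Fin N, ∑ z, cmpAt S hk i g z ^ 2) * Real.sqrt (∑ i : Fin N, ∑ z, cmpAt S hk i g' z ^ 2)))) := by
        gcongr
    _ = c * P.mesh k ^ 2 * Real.exp (-(δ₀ * (R / (P.L : ℝ) ^ k))) * Real.sqrt (siteInner g g)
          * Real.sqrt (siteInner g' g') := by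
        rw [hsumg, hsumg']
        have hε' : P.mesh 0 ^ P.d * (P.mesh 0 ^ P.d)⁻¹ = 1 := mul_inv_cancel₀ hε.ne'
        calc P.mesh 0 ^ P.d * (P.mesh k ^ 2 * (c * Real.exp (-(δ₀ * (R / (P.L : ℝ) ^ k))) *
              (Real.sqrt ((P.mesh 0 ^ P.d)⁻¹) * Real.sqrt (siteInner g g) *
                (Real.sqrt ((P.mesh 0 ^ P.d)⁻¹) * Real.sqrt (siteInner g' g')))))
            = (P.mesh 0 ^ P.d * (Real.sqrt ((P.mesh 0 ^ P.d)⁻¹) * Real.sqrt ((P.mesh 0 ^ P.d)⁻¹))) *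
                (c * P.mesh k ^ 2 * Real.exp (-(δ₀ * (R / (P.L : ℝ) ^ k))) * Real.sqrt (siteInner g g)
                  * Real.sqrt (siteInner g' g')) := by ring
          _ = _ := by rw [hsqε, hε', one_mul]

end Pairing

/-! ## §2 Prop. 2.3 (2.34)/(2.36) at zero field on the whole torus — unconditional on the sub-family -/

section Prop23

/-- **PROP. 2.3 (2.34) AT ZERO FIELD ON THE WHOLE TORUS, WITH NO DISPLAYED INPUT, ON THE SUB-FAMILY `M·L′_μ = L^m`**: for `d ≧ 1`, odd
`L > 1`, `a > 0`, `m² > 0` and `N` there are `δ₀ > 0`, `c₀ ≧ 0` such that on every torus of the sub-family, for every coupling `C` and every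
`1 ≦ k < K` with `L^kε ≦ 1`: `|C^{(k)}_Λ(T_ε, 0; p, q)| ≦ c₁e^{−δ₁|x_p − x_q|}` on every `Λ ⊂ T^{(k)}`, with r14's explicit `(c₁, δ₁)` —
`B1Ineq233LowerZeroFieldTorus.ineq234_zeroField_of_sep` with `hSep` := `propagatorK_pairing_bound` (`(L^kε)² ≦ 1`).
[cite: Balaban1982Higgs1, Prop. 2.3 (2.34) p.611] -/
theorem ineq234_zeroField_torus (d L N : ℕ) (hd : 1 ≤ d) (hL : Odd L ∧ 1 < L) {a : ℝ} (ha : 0 < a) {msq : ℝ} (hmsq : 0 < msq) :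
    ∃ δ₀ c₀ : ℝ, 0 < δ₀ ∧ 0 ≤ c₀ ∧ ∀ (P : HiggsLattice.Params) (_S : Shape P), P.d = d → P.L = L →
      ∀ (C : ChargeData N) {j : ℕ}, j + 1 < P.K → P.mesh (j + 1) ≤ 1 →
        ∀ (Λ : Finset (HiggsLattice.Site P (j + 1))) {p q : HiggsLattice.Site P (j + 1) × B1Eq230FluctCov.Ix N},
          p.1 ∈ Λ → q.1 ∈ Λ →
          |B1Eq230FluctCov.mat (HiggsCondCov232.condCov232 C Finset.univ (0 : HiggsLattice.VecField P 0) msq a (j + 1) Λ) p q| ≤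
            B4Sect5Torus.cSt (B1Ineq234Concrete.profile P N) (min a (8 * B2Prop31ZeroFieldConcrete.gamma0 P a msq) / (P.L : ℝ) ^ 2)
                (a * ((P.mesh (j + 1 + 1))⁻¹ ^ 2) * Real.exp (δ₀ * ((P.L : ℝ) - 1)) +
                  (|HiggsFluctMeasure.coeff221 P a (j + 1)| + HiggsFluctMeasure.coeff221 P a (j + 1) ^ 2 * (c₀ * Real.exp δ₀))) δ₀ *
              Real.exp (-(B4Sect5Torus.dSt (B1Ineq234Concrete.profile P N)
                (min a (8 * B2Prop31ZeroFieldConcrete.gamma0 P a msq) / (P.L : ℝ) ^ 2)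
                (a * ((P.mesh (j + 1 + 1))⁻¹ ^ 2) * Real.exp (δ₀ * ((P.L : ℝ) - 1)) +
                  (|HiggsFluctMeasure.coeff221 P a (j + 1)| + HiggsFluctMeasure.coeff221 P a (j + 1) ^ 2 * (c₀ * Real.exp δ₀))) δ₀ *
                (HiggsLattice.Site.tdist p.1 q.1 : ℝ))) := by
  obtain ⟨δ₀, c₀, hδ₀, hc₀, hpair⟩ := propagatorK_pairing_bound d L N hd hL ha hmsq.le 1
  refine ⟨δ₀, c₀, hδ₀, hc₀.le, fun P S hPd hPL C j hjK hs Λ p q hp hq => ?_⟩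
  have hL1 : 1 < P.L := by rw [hPL]; exact hL.2
  refine B1Ineq233LowerZeroFieldTorus.ineq234_zeroField_of_sep C ha hL1 hmsq hjK hs hc₀.le hδ₀ ?_ Λ hp hq
  intro R g g' hRsep
  have h := hpair P S hPd hPL C (Nat.succ_le_succ (Nat.zero_le j)) hjK.le hs R g g' hRsep
  refine h.trans ?_
  have hℓ2 : P.mesh (j + 1) ^ 2 ≤ 1 := pow_le_one₀ (P.mesh_pos _).le hs
  have hrest : 0 ≤ Real.exp (-(δ₀ * (R / (P.L : ℝ) ^ (j + 1)))) * Real.sqrt (siteInner g g) * Real.sqrt (siteInner g' g') := by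
    positivity
  calc c₀ * P.mesh (j + 1) ^ 2 * Real.exp (-(δ₀ * (R / (P.L : ℝ) ^ (j + 1)))) * Real.sqrt (siteInner g g)
        * Real.sqrt (siteInner g' g')
      = (c₀ * P.mesh (j + 1) ^ 2) * (Real.exp (-(δ₀ * (R / (P.L : ℝ) ^ (j + 1)))) * Real.sqrt (siteInner g g)
          * Real.sqrt (siteInner g' g')) := by ring
    _ ≤ (c₀ * 1) * (Real.exp (-(δ₀ * (R / (P.L : ℝ) ^ (j + 1)))) * Real.sqrt (siteInner g g)
          * Real.sqrt (siteInner g' g')) :=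
        mul_le_mul_of_nonneg_right (mul_le_mul_of_nonneg_left hℓ2 hc₀.le) hrest
    _ = c₀ * Real.exp (-(δ₀ * (R / (P.L : ℝ) ^ (j + 1)))) * Real.sqrt (siteInner g g) * Real.sqrt (siteInner g' g') := by
        ring

/-- **PROP. 2.3 (2.36) AT ZERO FIELD ON THE WHOLE TORUS, WITH NO DISPLAYED INPUT, ON THE SUB-FAMILY**: the same inputs give
`|δC^{(k)}_Λ(T_ε, 0; p, q)| ≦ c₁e^{−δ₁(dist(x_p,Λᶜ) + |x_p − x_q| + dist(x_q,Λᶜ))}` with r14's explicit `(c₁, δ₁)` —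
`B1Ineq233LowerZeroFieldTorus.ineq236_zeroField_of_sep` with `hSep` := `propagatorK_pairing_bound`. [cite: Balaban1982Higgs1, Prop. 2.3 (2.36) p.612] -/
theorem ineq236_zeroField_torus (d L N : ℕ) (hd : 1 ≤ d) (hL : Odd L ∧ 1 < L) {a : ℝ} (ha : 0 < a) {msq : ℝ} (hmsq : 0 < msq) :
    ∃ δ₀ c₀ : ℝ, 0 < δ₀ ∧ 0 ≤ c₀ ∧ ∀ (P : HiggsLattice.Params) (_S : Shape P), P.d = d → P.L = L →
      ∀ (C : ChargeData N) {j : ℕ}, j + 1 < P.K → P.mesh (j + 1) ≤ 1 →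
        ∀ (Λ : Finset (HiggsLattice.Site P (j + 1))) {p q : HiggsLattice.Site P (j + 1) × B1Eq230FluctCov.Ix N},
          p.1 ∈ Λ → q.1 ∈ Λ →
          |B1Eq230FluctCov.mat (HiggsCondCov232.deltaCov235 C Finset.univ (0 : HiggsLattice.VecField P 0) msq a (j + 1) Λ) p q| ≤
            B4Sect5Torus.cSt (B1Ineq234Concrete.profile P N) (min a (8 * B2Prop31ZeroFieldConcrete.gamma0 P a msq) / (P.L : ℝ) ^ 2)
                (a * ((P.mesh (j + 1 + 1))⁻¹ ^ 2) * Real.exp (δ₀ * ((P.L : ℝ) - 1)) +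
                  (|HiggsFluctMeasure.coeff221 P a (j + 1)| + HiggsFluctMeasure.coeff221 P a (j + 1) ^ 2 * (c₀ * Real.exp δ₀))) δ₀ *
              Real.exp (-(B4Sect5Torus.dSt (B1Ineq234Concrete.profile P N)
                (min a (8 * B2Prop31ZeroFieldConcrete.gamma0 P a msq) / (P.L : ℝ) ^ 2)
                (a * ((P.mesh (j + 1 + 1))⁻¹ ^ 2) * Real.exp (δ₀ * ((P.L : ℝ) - 1)) +
                  (|HiggsFluctMeasure.coeff221 P a (j + 1)| + HiggsFluctMeasure.coeff221 P a (j + 1) ^ 2 * (c₀ * Real.exp δ₀))) δ₀ *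
                ((HiggsLattice.Site.tdist p.1 q.1 : ℝ) + B1Ineq234Concrete.distC Λ p.1 + B1Ineq234Concrete.distC Λ q.1))) := by
  obtain ⟨δ₀, c₀, hδ₀, hc₀, hpair⟩ := propagatorK_pairing_bound d L N hd hL ha hmsq.le 1
  refine ⟨δ₀, c₀, hδ₀, hc₀.le, fun P S hPd hPL C j hjK hs Λ p q hp hq => ?_⟩
  have hL1 : 1 < P.L := by rw [hPL]; exact hL.2
  refine B1Ineq233LowerZeroFieldTorus.ineq236_zeroField_of_sep C ha hL1 hmsq hjK hs hc₀.le hδ₀ ?_ Λ hp hq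
  intro R g g' hRsep
  have h := hpair P S hPd hPL C (Nat.succ_le_succ (Nat.zero_le j)) hjK.le hs R g g' hRsep
  refine h.trans ?_
  have hℓ2 : P.mesh (j + 1) ^ 2 ≤ 1 := pow_le_one₀ (P.mesh_pos _).le hs
  have hrest : 0 ≤ Real.exp (-(δ₀ * (R / (P.L : ℝ) ^ (j + 1)))) * Real.sqrt (siteInner g g) * Real.sqrt (siteInner g' g') := by
    positivity
  calc c₀ * P.mesh (j + 1) ^ 2 * Real.exp (-(δ₀ * (R / (P.L : ℝ) ^ (j + 1)))) * Real.sqrt (siteInner g g)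
        * Real.sqrt (siteInner g' g')
      = (c₀ * P.mesh (j + 1) ^ 2) * (Real.exp (-(δ₀ * (R / (P.L : ℝ) ^ (j + 1)))) * Real.sqrt (siteInner g g)
          * Real.sqrt (siteInner g' g')) := by ring
    _ ≤ (c₀ * 1) * (Real.exp (-(δ₀ * (R / (P.L : ℝ) ^ (j + 1)))) * Real.sqrt (siteInner g g)
          * Real.sqrt (siteInner g' g')) :=
        mul_le_mul_of_nonneg_right (mul_le_mul_of_nonneg_left hℓ2 hc₀.le) hrest
    _ = c₀ * Real.exp (-(δ₀ * (R / (P.L : ℝ) ^ (j + 1)))) * Real.sqrt (siteInner g g) * Real.sqrt (siteInner g' g') := by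
        ring

end Prop23

end Literature.MathematicalPhysics.QuantumFieldTheory.Balaban1983to89.B1Cor23ZeroFieldTorus
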